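import Summits.BirchSwinnertonDyer.BirchSwinnertonDyer.Theorems.ManinLocalTwoThreeMinimalCubeRootIntegral
import Summits.BirchSwinnertonDyer.BirchSwinnertonDyer.Theorems.ManinLocalTwoThreeKummerSqRootTwoAdicallyBounded
import Summits.BirchSwinnertonDyer.BirchSwinnertonDyer.Theorems.ManinLocalTwoThreeTwoTorsionIdentityComponentAtFour
import HarnessLib

/-!
# The ℓ = 2 witness line, piece (INT₂): the square root on the MINIMAL model is INTEGRAL — `g = ρ⁻¹·h ∈ ℤ⟦q⟧`
(route `ManinLocalTwoThree`, deciding crux C2 `ManinOddAtFour` stmt-BirchSwinnertonDyer-22967; cell bsd-f2-manin, prover p2 gen 19; LEAD-MEMO v35 §3–§4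
«the ℓ = 2 UDC chain», toward the witness law AN2₂ of p2's `…UDCGlueTwo`; the ℓ = 2 port of p3 g15's (INT)/(AN1) `MinimalCubeRoot.exists_int_minimalCubeRoot`;
`--supports stmt-BirchSwinnertonDyer-22967`)

Setting: `W` globally minimal, `D` a datum (`c = D.c`), `aₙ = aₙ(f)`, `4 ∣ N`, `e ∈ ℚ` a root of the `2`-division polynomial of `W` (so `T = (e, ·)` is a
rational `2`-torsion point), `z` the short germ (`log_{E_{W,c}}(z) = Σ aₙqⁿ/n`), `h` a normalised square root of the Kummer series
(`h² = Ξ_T = kummerSeries W c e z`, `h(0) = 1`) with `2`-adically integral coefficients (the conclusion of (BI₂), p2's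
`kummerSqRoot_unique_twoAdicallyIntegral`).  Put `z_W := exp_W(c·Σ aₙqⁿ/n)` (the germ of the MINIMAL model, `∈ ℤ⟦q⟧` by Honda) and `ρ := c·z/z_W`.
* §1 `isPadicInt_of_sq_eq`, `not_dvd_den_coeff_of_sq_eq` — at a prime `p ≠ 2`, a square root with unit constant term of a `p`-integral series is
  `p`-integral (strong induction on the degree: `Ξₙ = (t²)ₙ + 2h₀hₙ`); the port of p3's `isPadicInt_of_pow_three_eq`;
* §2 `kummerSeries_mul_sq_eq` — the transport identity `Ξ_T(z)·z_W² = (cz)²·Ξ^{min}(z_W)` with **`Ξ^{min} := X_W(z_W) − e·z_W²`** (p3's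
  `formalXMulSq_shortGerm_mul_sq`: `X_s(z)z_W² = c²z²(X_W + (b₂/12)z_W²)`, and `x_s(T) = c²(e + b₂/12)`);
* §3 **`exists_int_minimalSqRoot`** — there is `g ∈ ℚ⟦q⟧` with INTEGER coefficients, `g(0) = 1`, `c·(z·g) = z_W·h` and `g² = Ξ^{min}(z_W)`.
  Proof (p3's architecture): `g := ρ⁻¹h` with `ρ⁻¹ = D'·U⁻¹` (cleared `θ`, `ShortGermTransport.shortGerm_mul_eq'`); `g² = Ξ^{min}` by §2; `Ξ^{min} ∈ ℤ⟦q⟧`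
  because `z_W ∈ ℤ⟦q⟧` (Honda, `exists_int_coeff_formalExp_subst_lSeriesLog`), `X_W` has integer coefficients on the integral model, and **`e ∈ ℤ`**
  (`4 ∣ N` ⟹ additive at `2` ⟹ `a₁, a₃` even ⟹ the `2`-division cubic is `4×` a monic integer cubic — LEAD's `exists_int_twoTorsionPoint_of_even`);
  at `p ≠ 2` by §1; at `p = 2`: `z ∈ Frac ℤ⟦q⟧` (`exists_int_frac_formalVariableChange_subst`) gives `A·g = B` with `A ≠ 0`, `B ∈ ℤ₂⟦q⟧` (`h ∈ ℤ₂⟦q⟧`),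
  and `A²·Ξ^{min} = B²` in the UFD `ℤ₂⟦q⟧` gives `A ∣ B`, i.e. `g ∈ ℤ₂⟦q⟧`.
HONEST FRAMING.  The integrality input of the ℓ = 2 witness; the witness law AN2₂ (assembly, next file), CDT, C2, Manin's conjecture and BSD are NOT
proved here.  No definitions, no sorry.
[cite: SilvermanAEC2009, IV.1–IV.2 (formal group expansions over ℤ[a₁,…,a₆]), III.1 (changes of variables), VIII.7 (integral 2-torsion; shape)]
[cite: Honda1968, Thm. 5 (through the tree theorem `exists_int_coeff_formalExp_subst_lSeriesLog`)] [cite: Washington1997, Thm. 7.3 and §7.1 (ℤ_p⟦T⟧ is a UFD)]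
-/

set_option autoImplicit false
-- lint-debt: the directory name repeats the summit name (sibling precedent `ManinLocalTwoThreeMinimalCubeRootIntegral.lean`)
set_option linter.dupNamespace false

noncomputable section

open scoped Classical
open PowerSeries Finset WeierstrassCurve Literature.NumberTheory.EllipticCurves Literature.NumberTheory.EllipticCurves.ModularForms
open Summit.BirchSwinnertonDyer.Rank1Residual.ManinAdditive.CuspidalKummer
open Summit.BirchSwinnertonDyer.BirchSwinnertonDyer.Theorems.ManinLocalTwoThree.ShortGermTransport
open Summit.BirchSwinnertonDyer.BirchSwinnertonDyer.Theorems.ManinLocalTwoThree.KummerCubeRootBounded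
open Summit.BirchSwinnertonDyer.BirchSwinnertonDyer.Theorems.ManinLocalTwoThree.KummerSqRootBounded
open Summit.BirchSwinnertonDyer.BirchSwinnertonDyer.Theorems.ManinLocalTwoThree.MinimalCubeRoot

namespace Summit.BirchSwinnertonDyer.BirchSwinnertonDyer.Theorems.ManinLocalTwoThree.MinimalSqRoot

/-! ## §1 Square roots are `p`-integral away from `2` -/

section AwayFromTwo

variable {p : ℕ} [Fact p.Prime]

/-- **A square root with unit constant term of a `p`-integral series is `p`-integral, `p ≠ 2`**: by strong induction on the degree,
`Ξₙ = (t²)ₙ + 2h₀hₙ` where `t` is the truncation of `h` below `n`. [folklore] -/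
theorem isPadicInt_of_sq_eq (hp2 : p ≠ 2) {Ξ h : ℚ_[p]⟦X⟧} (hΞ : IsPadicInt Ξ) (hh : h ^ 2 = Ξ)
    (hh0 : ‖constantCoeff h‖ = 1) : IsPadicInt h := by
  rw [isPadicInt_iff_coeff]
  intro n
  induction n using Nat.strong_induction_on with
  | _ n ih =>
    rcases Nat.eq_zero_or_pos n with rfl | hn
    · rw [coeff_zero_eq_constantCoeff, hh0]
    set t : ℚ_[p]⟦X⟧ := PowerSeries.mk fun m ↦ if m < n then coeff m h else 0 with ht
    set r : ℚ_[p]⟦X⟧ := h - t with hrdef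
    have hr : ∀ i < n, coeff i r = 0 := fun i hi ↦ by simp [hrdef, ht, coeff_mk, hi]
    have hrn : coeff n r = coeff n h := by simp [hrdef, ht, coeff_mk]
    have ht0 : constantCoeff t = constantCoeff h := by
      rw [← coeff_zero_eq_constantCoeff, ht, coeff_mk, if_pos hn, coeff_zero_eq_constantCoeff]
    have htint : IsPadicInt t := by
      rw [isPadicInt_iff_coeff]; intro m
      rw [ht, coeff_mk]
      split_ifs with hm
      · exact ih m hm
      · simp
    have hr2 : coeff n (r * r) = 0 := by
      rw [coeff_mul_of_coeff_lt_eq_zero hr le_rfl, ← coeff_zero_eq_constantCoeff, hr 0 hn, zero_mul]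
    have htr : coeff n (t * r) = constantCoeff h * coeff n h := by
      rw [coeff_mul_of_coeff_lt_eq_zero hr le_rfl, ht0, hrn]
    have hexp : coeff n Ξ = coeff n (t ^ 2) + 2 * (constantCoeff h * coeff n h) := by
      have e : Ξ = t ^ 2 + 2 * (t * r) + r * r := by
        rw [← hh, show h = t + r by rw [hrdef]; ring]; ring
      rw [e, map_add, map_add, hr2, add_zero, show (2 : ℚ_[p]⟦X⟧) = C (2 : ℚ_[p]) from (map_ofNat C 2).symm, coeff_C_mul, htr]
    have h2 : ‖(2 : ℚ_[p])‖ = 1 := by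
      have hcop : p.Coprime 2 := (Nat.coprime_primes (Fact.out : p.Prime) Nat.prime_two).mpr hp2
      have h := (Padic.norm_natCast_eq_one_iff (p := p) (n := 2)).mpr hcop
      exact_mod_cast h
    have hunit : ‖2 * constantCoeff h‖ = 1 := by rw [norm_mul, h2, hh0]; norm_num
    have hsolve : coeff n h = (coeff n Ξ - coeff n (t ^ 2)) * (2 * constantCoeff h)⁻¹ := by
      have hne : (2 : ℚ_[p]) * constantCoeff h ≠ 0 := by
        intro h0; rw [h0, norm_zero] at hunit; exact zero_ne_one hunit
      rw [eq_mul_inv_iff_mul_eq₀ hne]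
      linear_combination -hexp
    rw [hsolve, norm_mul, norm_inv, hunit, inv_one, mul_one]
    have hΞn := (isPadicInt_iff_coeff.mp hΞ) n
    have ht2n := (isPadicInt_iff_coeff.mp (htint.pow 2)) n
    rw [sub_eq_add_neg]
    exact (Padic.nonarchimedean _ _).trans (max_le hΞn (by rwa [norm_neg]))

/-- **Rational reading**: for `Ξ ∈ ℚ⟦X⟧` with `p`-integral coefficients (`p ≠ 2`), `h² = Ξ` and `h(0) = 1`, no coefficient of `h` has `p` in its
denominator. [folklore] -/
theorem not_dvd_den_coeff_of_sq_eq (hp2 : p ≠ 2) {Ξ h : ℚ⟦X⟧} (hΞ : ∀ n, ¬ p ∣ (coeff n Ξ).den) (hh : h ^ 2 = Ξ)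
    (hh0 : constantCoeff h = 1) (n : ℕ) : ¬ p ∣ (coeff n h).den := by
  set ι : ℚ⟦X⟧ →+* ℚ_[p]⟦X⟧ := PowerSeries.map (algebraMap ℚ ℚ_[p]) with hι
  have hΞp : IsPadicInt (ι Ξ) := by
    rw [isPadicInt_iff_coeff]; intro m
    rw [hι, coeff_map, eq_ratCast]
    exact Padic.norm_rat_le_one (hΞ m)
  have hhp : IsPadicInt (ι h) := by
    refine isPadicInt_of_sq_eq hp2 hΞp (by rw [← map_pow, hh]) ?_
    rw [hι, ← coeff_zero_eq_constantCoeff, coeff_map, coeff_zero_eq_constantCoeff, hh0]; simp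
  have hn := (isPadicInt_iff_coeff.mp hhp) n
  rw [hι, coeff_map, eq_ratCast] at hn
  exact not_dvd_den_of_norm_ratCast_le_one hn

end AwayFromTwo

/-! ## §2 `Ξ_T(z)·z_W² = (cz)²·(X_W(z_W) − e·z_W²)` -/

/-- **The Kummer series on the two models**: `Ξ_T(z)·z_W² = (c·z)²·(X_W(z_W) − e·z_W²)` (`x_s − x_s(T) = c²·(x_W − e)` read through the germs).
[cite: SilvermanAEC2009, III.1 and IV.1] -/
theorem kummerSeries_mul_sq_eq (W : WeierstrassCurve ℚ) {c : ℤ} (hc : c ≠ 0) (a : ℕ → ℤ) {z : ℚ⟦X⟧} (hz : IsParamGerm W c a z) (e : ℚ) :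
    kummerSeries W c e z * W.formalExp.subst ((c : ℚ) • lSeriesLog a) ^ 2 =
      (C (c : ℚ) * z) ^ 2 * (W.formalXMulSq.subst (W.formalExp.subst ((c : ℚ) • lSeriesLog a))
        - C e * W.formalExp.subst ((c : ℚ) • lSeriesLog a) ^ 2) := by
  have hc' : (c : ℚ) ≠ 0 := by exact_mod_cast hc
  set vc : VariableChange ℚ := ⟨Units.mk0 ((c : ℚ)⁻¹) (inv_ne_zero hc'), -(W.b₂ / 12), -(W.a₁ / 2),
    W.a₁ * W.b₂ / 24 - W.a₃ / 2⟩ with hvc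
  have hX := formalXMulSq_shortGerm_mul_sq W hc vc (by rw [hvc, Units.val_mk0]) rfl rfl rfl a hz
  set zW := W.formalExp.subst ((c : ℚ) • lSeriesLog a) with hzW
  have hsm : shortRoot W c e • z ^ 2 = C ((c : ℚ) ^ 2 * (e + W.b₂ / 12)) * z ^ 2 := by
    rw [smul_eq_C_mul, shortRoot]
  rw [kummerSeries, sub_mul, hX, hsm, map_mul, map_pow, map_add]
  ring

/-! ## §3 (INT₂): the minimal square root is integral -/

/-- **(INT₂): `g = ρ⁻¹h ∈ ℤ⟦q⟧`.**  Under the hypotheses of the file header (`4 ∣ N`, `e` a rational `2`-division root, THE germ `z`, `h² = Ξ_T(z)`,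
`h(0) = 1`, `h` `2`-adically integral), with `z_W = exp_W(c·Σaₙqⁿ/n)`: there is `g ∈ ℚ⟦q⟧` with integer coefficients, `g(0) = 1`, `c·(z·g) = z_W·h`, and
`g² = X_W(z_W) − e·z_W²` (the Kummer series of `T` on the minimal model).  See the module docstring for the proof.
[cite: SilvermanAEC2009, IV.1–IV.2 and III.1] [cite: Washington1997, Thm. 7.3 and §7.1] -/
theorem exists_int_minimalSqRoot (W : WeierstrassCurve ℚ) [W.IsElliptic] [W.IsGloballyMinimal] {N : ℕ} [NeZero N]
    (D : ModularParametrizationData W N) (a : ℕ → ℤ) (ha : ∀ n, (a n : ℂ) = cuspCoeff D.f n) (h4 : 4 ∣ N)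
    (e : ℚ) (he : W.twoTorsionPolynomial.toPoly.IsRoot e) (z : ℚ⟦X⟧) (hz : IsParamGerm W D.c a z)
    (h : ℚ⟦X⟧) (hh2 : h ^ 2 = kummerSeries W D.c e z) (hh0 : constantCoeff h = 1) (hb : ∀ n : ℕ, ¬ (2 ∣ (coeff n h).den)) :
    ∃ g : ℚ⟦X⟧, (∀ n, (coeff n g).den = 1) ∧ constantCoeff g = 1 ∧
      (D.c : ℚ) • (z * g) = W.formalExp.subst ((D.c : ℚ) • lSeriesLog a) * h ∧
      g ^ 2 = W.formalXMulSq.subst (W.formalExp.subst ((D.c : ℚ) • lSeriesLog a))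
        - C e * W.formalExp.subst ((D.c : ℚ) • lSeriesLog a) ^ 2 := by
  -- §A notation and basic facts
  have hc : D.c ≠ 0 := D.maninConstant_ne_zero_holds
  have hc' : (D.c : ℚ) ≠ 0 := by exact_mod_cast hc
  set c : ℤ := D.c with hcdef
  set L := lSeriesLog a with hL
  set zW := W.formalExp.subst ((c : ℚ) • L) with hzW
  have hcL0 : constantCoeff ((c : ℚ) • L) = 0 := constantCoeff_smul_lSeriesLog c a
  have hzW0 : constantCoeff zW = 0 := constantCoeff_formalExp_subst W hcL0
  have hzWs : HasSubst zW := HasSubst.of_constantCoeff_zero' hzW0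
  have hz0 : constantCoeff z = 0 := hz.1
  have hz1 : coeff 1 z = 1 := coeff_one_shortGerm W D a ha hz
  have hzne : z ≠ 0 := fun h0 ↦ by rw [h0, map_zero] at hz1; exact zero_ne_one hz1
  set P := W.formalXMulSq.subst zW with hP
  have hP0 : constantCoeff P = 1 := by rw [hP, constantCoeff_subst_eq_constantCoeff hzW0, constantCoeff_formalXMulSq]
  -- `Ξ^{min}(z_W)` and the transport identities
  set Ξm : ℚ⟦X⟧ := P - C e * zW ^ 2 with hΞm
  have hsq : kummerSeries W c e z * zW ^ 2 = (C (c : ℚ) * z) ^ 2 * Ξm := kummerSeries_mul_sq_eq W hc a hz e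
  have hθ := shortGerm_mul_eq' W hc a hz
  rw [← hL, ← hzW, ← hP] at hθ
  -- §B `ρ⁻¹ = D'·U⁻¹` and `g = ρ⁻¹ h`
  set U : ℚ⟦X⟧ := P + C (W.b₂ / 12) * zW ^ 2 with hU
  set D' : ℚ⟦X⟧ := P - C (W.a₁ / 2) * zW * P - C (W.a₃ / 2) * zW ^ 3 with hD'
  have hU0 : constantCoeff U = 1 := by simp [hU, hP0, hzW0]
  have hD'0 : constantCoeff D' = 1 := by simp [hD', hP0, hzW0]
  set Ui : ℚ⟦X⟧ := PowerSeries.invOfUnit U 1 with hUi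
  have hUUi : U * Ui = 1 := by
    rw [hUi]; exact PowerSeries.mul_invOfUnit U 1 (by rw [hU0, Units.val_one])
  have hθ' : C (c : ℚ) * z * D' = zW * U := by rw [hD', hU]; linear_combination hθ
  have hzWeq : zW = C (c : ℚ) * z * (D' * Ui) := by
    linear_combination (-Ui) * hθ' - zW * hUUi
  set g : ℚ⟦X⟧ := D' * Ui * h with hg
  have hczg : C (c : ℚ) * z * g = zW * h := by rw [hg, hzWeq]; ring
  have hUi0 : constantCoeff Ui = 1 := by
    have := congrArg constantCoeff hUUi
    rw [map_mul, hU0, one_mul, map_one] at this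
    exact this
  have hg0 : constantCoeff g = 1 := by rw [hg, map_mul, map_mul, hD'0, hUi0, hh0]; norm_num
  -- `g² = Ξ^{min}(z_W)`: cancel `(c z)² ≠ 0`
  have hcz0 : (C (c : ℚ) * z) ^ 2 ≠ 0 := by
    refine pow_ne_zero 2 (mul_ne_zero ?_ hzne)
    intro h0; apply hc'; simpa using congrArg constantCoeff h0
  have hg2 : g ^ 2 = Ξm := by
    have e2 : (C (c : ℚ) * z) ^ 2 * g ^ 2 = (C (c : ℚ) * z) ^ 2 * Ξm := by
      rw [← hsq, ← hh2, hg]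
      have : zW ^ 2 = (C (c : ℚ) * z) ^ 2 * (D' * Ui) ^ 2 := by rw [hzWeq]; ring
      rw [this]; ring
    exact mul_left_cancel₀ hcz0 e2
  refine ⟨g, ?_, hg0, ?_, by rw [hg2, hΞm]⟩
  swap
  · rw [smul_eq_C_mul, ← hczg]; ring
  -- §C integrality of `Ξm`: the integer model, the integer germ, the integer abscissa
  set M : WeierstrassCurve ℤ := integralModelInt W with hM
  set φ : ℤ →+* ℚ := Int.castRingHom ℚ with hφ
  have hMW : M.map φ = W := map_integralModelInt W
  -- `z_W ∈ ℤ⟦q⟧`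
  have hzWint : ∀ n, ∃ k : ℤ, coeff n zW = k := fun n ↦ by
    rw [hzW, hL, lSeriesLog_eq_of_cuspCoeff W D a ha]
    exact DepletionAtTwo.ParamIntegral.exists_int_coeff_formalExp_subst_lSeriesLog W c n
  set zWz : ℤ⟦X⟧ := PowerSeries.mk fun n ↦ (coeff n zW).num with hzWz
  have hzWmap : PowerSeries.map φ zWz = zW := map_mk_num_eq hzWint
  have hzWz0 : constantCoeff zWz = 0 := by
    rw [← coeff_zero_eq_constantCoeff_apply, hzWz, coeff_mk, coeff_zero_eq_constantCoeff_apply, hzW0, Rat.num_zero]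
  have hzWzs : HasSubst zWz := HasSubst.of_constantCoeff_zero' hzWz0
  -- `X_W(z_W) ∈ ℤ⟦q⟧`
  set Pz : ℤ⟦X⟧ := M.formalXMulSq.subst zWz with hPz
  have hPmap : PowerSeries.map φ Pz = P := by
    rw [hPz, Literature.RingTheory.FormalGroups.map_subst_apply hzWzs, map_formalXMulSq, hMW, hzWmap]
  -- `e ∈ ℤ`: `4 ∣ N` ⟹ additive at `2` ⟹ `a₁, a₃` even ⟹ the `2`-division cubic is `4 ×` a monic integer cubic
  obtain ⟨ha2, hN2⟩ := lFunction_two_eq_zero_of_four_dvd W D.isNewformOf h4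
  have hadd := hasAdditiveReductionAt_two_of_lFunction_two_eq_zero W ha2 hN2
  obtain ⟨⟨x, hx⟩, ⟨y, hy⟩⟩ := even_a₁_and_even_a₃_of_hasAdditiveReductionAt_two W hadd
  have he' : (M.map (Int.castRingHom ℚ)).twoTorsionPolynomial.toPoly.eval e = 0 := by
    rw [← hφ, hMW]; exact he
  obtain ⟨e₀, he₀, -, -⟩ := exists_int_twoTorsionPoint_of_even M hx hy he'
  set Ξz : ℤ⟦X⟧ := Pz - C e₀ * zWz ^ 2 with hΞz
  have hCe : PowerSeries.map φ (C e₀) = C e := by rw [PowerSeries.map_C, hφ, eq_intCast, he₀]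
  have hΞmap : PowerSeries.map φ Ξz = Ξm := by
    rw [hΞz, hΞm]
    simp only [map_sub, map_mul, map_pow, hCe, hPmap, hzWmap]
  have hΞint : ∀ n, (coeff n Ξm).den = 1 := fun n ↦ by
    rw [← hΞmap, coeff_map, hφ, eq_intCast]; exact Rat.den_intCast _
  -- §D `p ≠ 2`
  have hne2 : ∀ (p : ℕ) [Fact p.Prime], p ≠ 2 → ∀ n, ¬ p ∣ (coeff n g).den := by
    intro p _ hp2 n
    refine not_dvd_den_coeff_of_sq_eq hp2 (fun m ↦ ?_) hg2 hg0 n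
    rw [hΞint m]; exact Nat.Prime.not_dvd_one Fact.out
  -- §E `p = 2`: `g ∈ Frac ℤ₂⟦q⟧` with an integral square, hence integral
  have h2 : ∀ n, ¬ 2 ∣ (coeff n g).den := by
    set ι : ℚ⟦X⟧ →+* ℚ_[2]⟦X⟧ := PowerSeries.map (algebraMap ℚ ℚ_[2]) with hι
    set κ : ℤ_[2]⟦X⟧ →+* ℚ_[2]⟦X⟧ := PowerSeries.map (PadicInt.Coe.ringHom (p := 2)) with hκ
    set ψ : ℤ⟦X⟧ →+* ℤ_[2]⟦X⟧ := PowerSeries.map (Int.castRingHom ℤ_[2]) with hψ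
    have hκinj : Function.Injective κ := PowerSeries.map_injective _ Subtype.val_injective
    have hψinj : Function.Injective ψ := PowerSeries.map_injective _ Int.cast_injective
    have hκint : ∀ G : ℤ_[2]⟦X⟧, IsPadicInt (κ G) := fun G ↦ isPadicInt_iff_exists_powerSeries_map.mpr ⟨G, rfl⟩
    have hικ : ∀ G : ℤ⟦X⟧, ι (PowerSeries.map φ G) = κ (ψ G) := fun G ↦ by
      rw [hι, hκ, hψ, hφ]
      change ((PowerSeries.map (algebraMap ℚ ℚ_[2])).comp (PowerSeries.map (Int.castRingHom ℚ))) G =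
        ((PowerSeries.map (PadicInt.Coe.ringHom (p := 2))).comp (PowerSeries.map (Int.castRingHom ℤ_[2]))) G
      rw [← PowerSeries.map_comp, ← PowerSeries.map_comp, RingHom.ext_int ((algebraMap ℚ ℚ_[2]).comp (Int.castRingHom ℚ))
        ((PadicInt.Coe.ringHom (p := 2)).comp (Int.castRingHom ℤ_[2]))]
    have hhint : IsPadicInt (ι h) := by
      rw [isPadicInt_iff_coeff]; intro n
      rw [hι, coeff_map, eq_ratCast]
      exact Padic.norm_rat_le_one (hb n)
    obtain ⟨H₀, hH₀⟩ := isPadicInt_iff_exists_powerSeries_map.mp hhint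
    -- `z ∈ Frac ℤ⟦q⟧` via the change of variables
    set vc : VariableChange ℚ := ⟨Units.mk0 ((c : ℚ)⁻¹) (inv_ne_zero hc'), -(W.b₂ / 12), -(W.a₁ / 2),
      W.a₁ * W.b₂ / 24 - W.a₃ / 2⟩ with hvc
    have hzθ : z = (W.formalVariableChange vc).subst zW :=
      shortGerm_eq_formalVariableChange_subst W hc vc (by rw [hvc, Units.val_mk0]) rfl rfl rfl a hz
    have hwmap : W.formalW.subst zW * PowerSeries.map φ (1 : ℤ⟦X⟧) = PowerSeries.map φ (M.formalW.subst zWz) := by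
      rw [map_one, mul_one, Literature.RingTheory.FormalGroups.map_subst_apply hzWzs, map_formalW, hMW, hzWmap]
    have hzmap : zW * PowerSeries.map φ (1 : ℤ⟦X⟧) = PowerSeries.map φ zWz := by rw [map_one, mul_one, hzWmap]
    obtain ⟨P', Q', hQ'0, hPQ'⟩ :=
      W.exists_int_frac_formalVariableChange_subst vc hzW0 one_ne_zero hzmap one_ne_zero hwmap
    rw [← hzθ] at hPQ'
    -- `A·g = B`: `A = c·P'`, `B = z_W·Q'·h`
    have hAB : C (c : ℚ) * PowerSeries.map φ P' * g = zW * PowerSeries.map φ Q' * h := by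
      linear_combination (PowerSeries.map φ Q') * hczg - (C (c : ℚ) * g) * hPQ'
    set A₀ : ℤ_[2]⟦X⟧ := C ((c : ℤ) : ℤ_[2]) * ψ P' with hA₀
    set B₀ : ℤ_[2]⟦X⟧ := ψ zWz * ψ Q' * H₀ with hB₀
    have hr : algebraMap ℚ ℚ_[2] (c : ℚ) = PadicInt.Coe.ringHom (p := 2) ((c : ℤ) : ℤ_[2]) := by
      rw [PadicInt.Coe.ringHom_apply, PadicInt.coe_intCast, eq_ratCast]
      push_cast
      rfl
    have hA : ι (C (c : ℚ) * PowerSeries.map φ P') = κ A₀ := by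
      rw [map_mul ι, hικ, hA₀, map_mul κ, hι, hκ, PowerSeries.map_C, PowerSeries.map_C, hr]
    have hH₀' : ι h = κ H₀ := hH₀.symm
    have hB : ι (zW * PowerSeries.map φ Q' * h) = κ B₀ := by
      rw [map_mul ι (zW * PowerSeries.map φ Q') h, hH₀', map_mul ι zW, ← hzWmap, hικ, hικ, hB₀, map_mul κ, map_mul κ]
    have hABp : κ A₀ * ι g = κ B₀ := by rw [← hA, ← hB, ← map_mul, hAB]
    -- the square: `A₀²·Ξ₂ = B₀²` in `ℤ₂⟦q⟧`
    have hg2p : (ι g) ^ 2 = κ (ψ Ξz) := by rw [← map_pow, hg2, ← hΞmap, hικ]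
    have hR : A₀ ^ 2 * ψ Ξz = B₀ ^ 2 := by
      apply hκinj
      rw [map_mul, map_pow, map_pow, ← hABp, mul_pow, hg2p]
    obtain ⟨g₀, hg₀⟩ : A₀ ∣ B₀ := dvd_of_sq_dvd_sq ⟨ψ Ξz, hR.symm⟩
    -- `A₀ ≠ 0`
    have hP'ne : P' ≠ 0 := by
      intro h0
      have : PowerSeries.map φ Q' = 0 ∨ z = 0 := by
        have e2 : z * PowerSeries.map φ Q' = 0 := by rw [hPQ', h0, map_zero]
        rcases mul_eq_zero.mp e2 with h1 | h1
        · exact Or.inr h1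
        · exact Or.inl h1
      rcases this with h1 | h1
      · exact hQ'0 (PowerSeries.map_injective φ Int.cast_injective (by rw [h1, map_zero]))
      · exact hzne h1
    have hA₀ne : A₀ ≠ 0 := by
      rw [hA₀]
      refine mul_ne_zero ?_ (fun h0 ↦ hP'ne (hψinj (by rw [h0, map_zero])))
      intro h0
      have h1 := congrArg constantCoeff h0
      rw [constantCoeff_C, map_zero] at h1
      have : ((c : ℤ) : ℤ_[2]) ≠ 0 := by exact_mod_cast hc
      exact this h1
    have hκA₀ne : κ A₀ ≠ 0 := fun h0 ↦ hA₀ne (hκinj (by rw [h0, map_zero]))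
    -- `g = g₀ ∈ ℤ₂⟦q⟧`
    have hgint : IsPadicInt (ι g) := by
      have e2 : κ A₀ * ι g = κ A₀ * κ g₀ := by rw [hABp, hg₀, map_mul]
      rw [mul_left_cancel₀ hκA₀ne e2]
      exact hκint g₀
    intro n
    refine not_dvd_den_of_norm_ratCast_le_one ?_
    have hn := (isPadicInt_iff_coeff.mp hgint) n
    rw [hι, coeff_map, eq_ratCast] at hn
    exact hn
  -- §F all primes
  intro n
  by_contra hne
  obtain ⟨p, hp, hpd⟩ := Nat.exists_prime_and_dvd hne
  haveI : Fact p.Prime := ⟨hp⟩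
  by_cases hp2 : p = 2
  · subst hp2; exact h2 n hpd
  · exact hne2 p hp2 n hpd

end Summit.BirchSwinnertonDyer.BirchSwinnertonDyer.Theorems.ManinLocalTwoThree.MinimalSqRoot

end
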